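import Summits.CriticalPhenomena.PercolationContinuityZ3.Theorems.Transplant.SkelPhiFaceExitPieces
import Summits.CriticalPhenomena.PercolationContinuityZ3.Theorems.Transplant.SkelPhiRunKits
import HarnessLib

/-!
# N1 ({±1} node), (F) kit layer, part K1 (hp-8 g33): **THE KIT CLAUSE OF A FACE-FRAME LEVEL FROM THE INPUTS AT EVERY CENTRE AND A ROUTE AT
# EVERY NEAR CENTRE** — the (F) twin of p1-g11's `hkits_runX` (SkelPhiRunKits) for hp-8's face frame `pr.frame φ t I b`: `kitClause_frame` (p288926)
# with (h2) the exit pieces `pexF` of `SkelPhiFaceExitPieces` (raw sides: x side half / y′ top piece; level sides: top piece for `I = 1`, side half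
# with signs against `v_β, v_α` for `I = 0`), (h1) the zone at the kit centre, far contacts through the window rim, and (h3) a ROUTE HYPOTHESIS at
# every centre in the enlarged level box (to be discharged by `faceRoute_of_bridge`, p291183: hop + bridge + band per near contact).

builds on p205010 (kernel theorem, internal audit signed; external expert review pending) — nothing in this file uses p205010; nothing here is a
claim about the open node `SamePDropOfSkeletonNeg`.
Lane `prim-bschramm`, seat `prim-hp-8` (gen 33); helper file (`--supports stmt-CriticalPhenomena-4575 --as helper`).
* `pexF` (the exit pieces of a face-frame level kit), `hPex_pexF` (their exit inequalities under the four lattice rooms);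
* **`hkits_face_of_route`**.
[cite: KozmaNitzan2024, §4 Lemma 10, Steps III–IV (pp. 19–21); Lemma 11 (pp. 22–23)] [cite: MartineauTassion2017, §3.2, §4.3 Lemma 4.2]
-/

noncomputable section

open scoped Classical

namespace Summit.CriticalPhenomena.PercolationContinuityZ3.Theorems.Transplant

namespace Skelφ

open MeasureTheory
open Literature.Probability.Percolation Literature.Probability.LatticeModels SimpleGraph KNLevels
open Literature.Barriers.CriticalPhenomena (graphBall graphBall_finite mem_graphBall_self graphBall_mono)
open Skel (winGraph winGraph_adj winGraph_le KitGeom)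
open SkelI (tanOff tanTgt tanTgt_mem)
open Literature.Probability.Percolation.KozmaNitzan.Cells (oth oth_ne eq_oth_of_ne oth_oth)

variable {V : Type} [DecidableEq V] {G : SimpleGraph V} [G.LocallyFinite] {φ : V → Site 2}

namespace FinePrm

variable (G φ) in
/-- **The exit pieces of a face-frame level kit** (face frame `pr.frame φ t I b`, short data `Q` at the centre, signs `e, f` against `v_β, v_α`):
level sides (`i = I`) — the outward top/bottom piece for `I = 1`, the side half `(σ₀e, −σ₀f)` for `I = 0`; raw sides (`i ≠ I`) — the outward x side
half for `b = 0`, the outward top/bottom piece for `b = 1`. [cite: MartineauTassion2017, §3.2] -/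
def pexF (I b : Fin 2) (Q : ShortPc V) (e f : ℤ) (i : Fin 2) (σ₀ : ℤˣ) (c : V) : Finset V :=
  if i = I then
    (if I = 1 then pgTopPieceW G φ c (Q.nS c) (Q.hS c) (Q.ℓS c) (Q.RS c) (σ₀ : ℤ) 1 (Q.vS c)
      else pgSideHalfW G φ c (Q.nS c) (Q.hS c) (Q.ℓS c) (Q.RS c) ((σ₀ : ℤ) * e) (-((σ₀ : ℤ) * f)))
  else
    (if b = 0 then pgSideHalfW G φ c (Q.nS c) (Q.hS c) (Q.ℓS c) (Q.RS c) (σ₀ : ℤ) 1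
      else pgTopPieceW G φ c (Q.nS c) (Q.hS c) (Q.ℓS c) (Q.RS c) (σ₀ : ℤ) 1 (Q.vS c))

omit [DecidableEq V] in
/-- **The exit inequalities of the face-frame pieces** under the four lattice rooms (only the two matching `(I, b)` are used).
[cite: MartineauTassion2017, §3.2] [cite: KozmaNitzan2024, §4 Lemma 10 Step IV] -/
theorem hPex_pexF (pr : FinePrm) (t : V) (I b : Fin 2) (hc : 0 < pr.cOf I) (hA : pr.A ≠ 0) (hnz : pr.lvGen I b ≠ 0) (hD : 0 < pr.D)
    (hL : pr.cOf I * pr.L I ≤ pr.D) (Lo Hi : Site 2) (hA0 : 0 < pr.A) (hn : 0 ≤ pr.n) {e f : ℤ} (he : e = 1 ∨ e = -1) (hf : f = 1 ∨ f = -1)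
    (hev : e * pr.vβ = |pr.vβ|) (hfv : f * pr.vα = |pr.vα|) (Q : ShortPc V) (hnS : ∀ c, 1 ≤ Q.nS c) {A' kβ k₁ k₀ : ℤ}
    (hexα : b = 0 → ∀ c, A' + 2 * pr.D ≤ (Q.nS c : ℤ) * pr.D)
    (hexβ : b = 1 → A' + 2 * pr.D ≤ kβ * pr.D ∧
      ∀ c, kβ * Q.nS c ≤ (Q.nS c : ℤ) * Q.ℓS c - (shearUnit (Q.nS c) (Q.hS c) : ℤ) + 1 - |Q.hS c| * Q.nS c)
    (hex₁ : I = 1 → A' + pr.climC 1 b 1 + pr.D ≤ k₁ * pr.D ∧ ∀ c, (k₁ + 1) * pr.D * Q.nS c ≤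
      pr.c₁ * (pr.A * (pr.n * ((Q.nS c : ℤ) * Q.ℓS c - (shearUnit (Q.nS c) (Q.hS c) : ℤ) + 1) - |pr.n * Q.hS c - pr.h * Q.nS c| * Q.nS c)))
    (hex₀ : I = 0 → A' + pr.climC 0 b 0 + pr.D ≤ k₀ * pr.D ∧ ∀ c, (k₀ + 1) * pr.D ≤ pr.c₀ * (pr.A * (|pr.vβ| * Q.nS c - |pr.vα| * |Q.hS c|)))
    (i : Fin 2) (σ₀ : ℤˣ) (c : V) :
    ∀ v ∈ pexF G φ I b Q e f i σ₀ c, (pr.sideFormsU_frame φ t I b hc hA hnz hD Lo Hi i σ₀).lin (φ v) + A' + pr.climC I b i ≤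
      (pr.sideFormsU_frame φ t I b hc hA hnz hD Lo Hi i σ₀).lin (φ c) := by
  intro v hv
  unfold pexF at hv
  by_cases hi : i = I
  · subst hi
    rw [if_pos rfl] at hv
    obtain rfl | rfl : i = 0 ∨ i = 1 := by fin_cases i <;> simp
    · rw [if_neg (by decide)] at hv
      obtain ⟨h1, h2⟩ := hex₀ rfl
      exact pr.exit_frame_lv_zero_sideHalf φ t b hc hA hnz hD hL Lo Hi σ₀ hA0 he hf hev hfv h1 (hnS c) (h2 c) hv
    · rw [if_pos rfl] at hv
      obtain ⟨h1, h2⟩ := hex₁ rfl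
      exact pr.exit_frame_lv_one_topPiece φ t b hc hA hnz hD hL Lo Hi σ₀ hA0 hn h1 (hnS c) (h2 c) hv
  · rw [if_neg hi] at hv
    obtain rfl : i = oth I := eq_oth_of_ne hi
    obtain rfl | rfl : b = 0 ∨ b = 1 := by fin_cases b <;> simp
    · rw [if_pos rfl] at hv
      exact pr.exit_frame_raw_sideHalf φ t I hc hA hnz hD hL Lo Hi σ₀ (hexα rfl c) hv
    · rw [if_neg (by decide)] at hv
      obtain ⟨h1, h2⟩ := hexβ rfl
      exact pr.exit_frame_raw_topPiece φ t I hc hA hnz hD hL Lo Hi σ₀ h1 (hnS c) (h2 c) hv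

end FinePrm

/-- **THE KIT CLAUSE OF A FACE-FRAME LEVEL FROM THE INPUTS AT EVERY CENTRE AND A ROUTE AT EVERY NEAR CENTRE** (`hkits` of `kitsAt` / of
`faceOblRM_fineN` at one level `j` of the face step): the window is hp-8's face frame `pr.frame φ t I b` about `w₀` (radius `R`), the level box
`[lo − j, hi + j]`, the region `D ⊇` the level window carries the subbox weighting `Wt`, the target `T` holds the far part of the level; inputs at
every centre `c`: the zone, the short exit links of the pieces `pexF`; and at every centre in the `E`-enlarged box within `B(w₀, R − r)` a ROUTE
`∃ Qt Ft, Ft ⊆ T ∧ Qt ⊆ D ∧ Ft ∩ zone = ∅ ∧ 1 − δ² < P_{Wt}(linkIn Qt seed Ft)`.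
[cite: KozmaNitzan2024, §4 Lemma 10 (pp. 17–21)] [cite: MartineauTassion2017, §4.3 Lemma 4.2] -/
theorem hkits_face_of_route [Countable V] {types : Finset V} (hlipφ : Lip G φ) (hstep : Steps G φ) (hfr : Frames G φ types)
    (hκ : CylConn G φ types) {Δ : ℕ} (hΔ : ∀ v, G.degree v ≤ Δ) {q : unitInterval} {δ : ℝ} (hδ : 0 < δ)
    -- the face frame
    (pr : FinePrm) (t : V) (I b : Fin 2) (hc₀ : 0 ≤ pr.c₀) (hc₁ : 0 ≤ pr.c₁) (hD : 0 < pr.D) (hL0 : pr.c₀ * pr.L 0 ≤ pr.D)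
    (hL1 : pr.c₁ * pr.L 1 ≤ pr.D) (hc : 0 < pr.cOf I) (hA0 : 0 < pr.A) (hn : 0 ≤ pr.n) (hb : |pr.lvGen I (oth b)| ≤ |pr.lvGen I b|)
    (hnz : pr.lvGen I b ≠ 0) {nF : ℕ} (hnC : (nF : ℤ) ≤ pr.cOf I * |pr.A| * |pr.lvGen I b|) (hU3 : pr.D ≤ 3 * (nF : ℤ))
    {e f : ℤ} (he : e = 1 ∨ e = -1) (hf : f = 1 ∨ f = -1) (hev : e * pr.vβ = |pr.vβ|) (hfv : f * pr.vα = |pr.vα|)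
    -- the level box and the window
    {lo hi : Site 2} {j : ℕ} {w₀ : V} {R r : ℕ}
    -- kit constants
    (P : ApronPrm) {nz Rs Kmax KCmax rs cS cU E : ℕ} (hPN : 3 ≤ P.N) (hA : P.A = (nz + 1 : ℕ) * pr.D + 1)
    (hd1 : P.W + P.ℓ ≤ P.d) (hD1 : P.W + P.ℓ + P.d + 2 ≤ shellD P) (hD2 : P.ℓ + Rs + P.d + 3 ≤ shellD P) (hDρ : Rs + 1 ≤ shellD P)
    (hℓ : 1 ≤ P.ℓ) (hW : Rs + P.ℓ ≤ P.W) (hKmax : (shellD P + P.W) * 3 ≤ Kmax) (hKCmax : (shellD P + nz + 1) * 3 ≤ KCmax)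
    (hR' : cylRadMax G φ types P.ℓ (Rs + KCmax + (P.W + Kmax)) ≤ P.R')
    (hwide : ∀ i, (lo - (j : Site 2)) i + 2 * tanOff P.ℓs P.M ≤ (hi + (j : Site 2)) i)
    (hdw : ∀ i, (lo - (j : Site 2)) i + (P.d + 2 : ℕ) ≤ (hi + (j : Site 2)) i)
    (hDw : ∀ i, (lo - (j : Site 2)) i + ((shellD P + 1 + P.d + KCmax + Rs : ℕ) : ℤ) ≤ (hi + (j : Site 2)) i)
    (hT : (P.W : ℤ) + Kmax + P.ℓ + 1 ≤ tanOff P.ℓs P.M) (hT' : (shellD P : ℤ) + KCmax + Rs ≤ tanOff P.ℓs P.M)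
    (hr₀ : P.N * (tanOff P.ℓs P.M + 2) + P.N * P.d + (P.W + Kmax + P.R') + (KCmax + Rs) ≤ P.r₀) (hR : P.r₀ ≤ R)
    (hrs : 2 * (1 + P.N * (tanOff P.ℓs P.M + 2) + P.N * P.d + (P.W + Kmax + P.R') + (KCmax + Rs)) ≤ rs)
    (hcS : (P.N + 1) * (tanOff P.ℓs P.M + 1) + (P.N + 1) * P.d + (2 * P.W + 1) * (Kmax + 1) * (Δ + 1) ^ P.R' ≤ cS)
    -- the reach of the kit centre: inside the `E`-enlargement, and `B(w₀, R − r)`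
    (hE : j + (P.N * (tanOff P.ℓs P.M + 1) + P.N * P.d + KCmax) ≤ E) (hreach : r + (P.N * (tanOff P.ℓs P.M + 1) + P.N * P.d + KCmax) ≤ P.r₀)
    -- the short region, the zone family, the short pieces and their rooms
    (Rg : V → Finset V) (hRg : ∀ c, ∀ u ∈ Rg c, u ∈ graphBall G c Rs) (hRgcard : ∀ c, (Rg c).card ≤ cU) (hcU1 : 1 ≤ cU)
    (Λc : V → ℕ → Finset V) (kz : ℕ) (hkn : ∀ c, Λc c kz ⊆ Λc c nz) (hΛ : ∀ c, ∀ v ∈ Λc c nz, v ∈ Rg c ∧ φ v - φ c ∈ box 2 nz)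
    (Q : ShortPc V) (hQRg : ∀ i σ₀ c, FinePrm.pexF G φ I b Q e f i σ₀ c ⊆ Rg c) (hnS : ∀ c, 1 ≤ Q.nS c) {kβ k₁ k₀ : ℤ}
    (hexα : b = 0 → ∀ c, P.A + 2 * pr.D ≤ (Q.nS c : ℤ) * pr.D)
    (hexβ : b = 1 → P.A + 2 * pr.D ≤ kβ * pr.D ∧
      ∀ c, kβ * Q.nS c ≤ (Q.nS c : ℤ) * Q.ℓS c - (shearUnit (Q.nS c) (Q.hS c) : ℤ) + 1 - |Q.hS c| * Q.nS c)
    (hex₁ : I = 1 → P.A + pr.climC 1 b 1 + pr.D ≤ k₁ * pr.D ∧ ∀ c, (k₁ + 1) * pr.D * Q.nS c ≤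
      pr.c₁ * (pr.A * (pr.n * ((Q.nS c : ℤ) * Q.ℓS c - (shearUnit (Q.nS c) (Q.hS c) : ℤ) + 1) - |pr.n * Q.hS c - pr.h * Q.nS c| * Q.nS c)))
    (hex₀ : I = 0 → P.A + pr.climC 0 b 0 + pr.D ≤ k₀ * pr.D ∧ ∀ c, (k₀ + 1) * pr.D ≤ pr.c₀ * (pr.A * (|pr.vβ| * Q.nS c - |pr.vα| * |Q.hS c|)))
    -- the level's source/support, the weighting on the region, the target
    (kk : ℕ) (o : V) (Sfin : Finset V) {Wt : Sym2 V → unitInterval} {D T : Finset V} (hWD : IsSubbox (winGraph G w₀ R) Wt q D)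
    (hXD : winLevel G (pr.frame φ t I b) w₀ R lo hi j ⊆ D)
    (hfarT : ∀ v ∈ winLevel G (pr.frame φ t I b) w₀ R lo hi j, v ∉ graphBall G w₀ (R - P.r₀) → v ∈ T)
    {N : ℕ} (hN : kk * (Δ + 1) ^ (2 * rs) ≤ N) (hk : (1 - (q : ℝ) ^ (1 + Δ * cS + cS * cU)) ^ kk ≤ δ)
    -- THE INPUTS AT EVERY CENTRE: zone, short exit links; THE ROUTE at every centre of the enlarged box near the window centre
    (hzone : ∀ c, 1 - δ ^ 2 < (bondPercolation G q).real (UniqZone.zone G (Λc c) kz nz))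
    (hexit : ∀ c (i : Fin 2) (σ₀ : ℤˣ), 1 - δ ^ 2 < (bondPercolation G q).real
      (linkIn (↑(Rg c) : Set V) (Λc c kz) (FinePrm.pexF G φ I b Q e f i σ₀ c)))
    (hroute : ∀ c, pr.frame φ t I b c ∈ Finset.Icc (lo - ((E : ℕ) : Site 2)) (hi + ((E : ℕ) : Site 2)) → c ∈ graphBall G w₀ (R - r) →
      ∃ Qt Ft : Finset V, Ft ⊆ T ∧ Qt ⊆ D ∧ Disjoint Ft (Λc c nz) ∧
        1 - δ ^ 2 < (prodBernoulli Wt).real (linkIn (↑Qt : Set V) (Λc c kz) Ft)) :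
    ∃ (σ' : SData V) (S : Finset V), SHyp (winLData G (pr.frame φ t I b) w₀ R lo hi o Sfin) j σ' ∧ σ'.N ≤ N ∧
      (1 - (q : ℝ) ^ σ'.sB) ^ σ'.k ≤ δ ∧ S ⊆ (winLData G (pr.frame φ t I b) w₀ R lo hi o Sfin).X j ∧ S ⊆ D ∧
      (∀ x ∈ σ'.K, ∀ e ∈ σ'.seed x, e ∉ wireSet (↑S : Set V)) ∧ (∀ x ∈ σ'.K, σ'.face x ⊆ S) ∧
      (∀ x ∈ σ'.K, 1 - 3 * δ ≤ (prodBernoulli Wt).real {ω | ∃ u ∈ σ'.face x,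
        1 - δ < (prodBernoulli (pinW Wt (wireSet (↑S : Set V)) ω)).real (⋃ t ∈ T, openConnIn (↑D : Set V) u t)}) := by
  set ψ := pr.frame φ t I b with hψ
  set SF := pr.sideFormsU_frame φ t I b hc hA0.ne' hnz hD (lo - (j : Site 2)) (hi + (j : Site 2)) with hSF
  have hKeq : winLevel G ψ w₀ R lo hi j = Win G ψ w₀ (Finset.Icc (lo - (j : Site 2)) (hi + (j : Site 2))) R := rfl
  have hLI : pr.cOf I * pr.L I ≤ pr.D := pr.cOf_mul_L_le hL0 hL1 I
  -- the frame facts used for the reach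
  have hlip : Lip G ψ := pr.lip_frame hlipφ t I b hc.le hD hLI
  have hU3' : pr.D ≤ 3 * (pr.cOf I * |pr.A| * |pr.lvGen I b|) := hU3.trans (by linarith only [hnC])
  have hq : QStepsN G ψ P.N := (qStepsN_of_qSteps (pr.qSteps_frame hstep t I b hc hA0.ne' hD hLI hb hnz hU3')).mono hPN
  have hU1 : (1 : ℤ) ≤ pr.D := hD
  have hnF1 : 1 ≤ nF := by
    have h3 : (0 : ℤ) < 3 * (nF : ℤ) := lt_of_lt_of_le hD hU3
    omega
  have hnD : (nF : ℤ) ≤ pr.D := hnC.trans ((pr.cOf_abs_lvGen_le I b hc.le).trans hLI)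
  have hU : pr.D ≤ ((2 + 1 : ℕ) : ℤ) * nF := by
    have e' : ((2 + 1 : ℕ) : ℤ) * nF = 3 * (nF : ℤ) := by push_cast; ring
    rw [e']; exact hU3
  have haff : ∀ (i : Fin 2) (σ₀ : ℤˣ), (SF i σ₀).IsAffine pr.D (pr.climC I b i) := fun i σ₀ => by
    rw [hSF]; exact pr.sideFormsU_frame_isAffine φ t I b hc hA0.ne' hnz hD hLI _ _ i σ₀
  have hC : ∀ (i : Fin 2) (σ₀ : ℤˣ), (nF : ℤ) ≤ pr.climC I b i := fun i σ₀ => by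
    unfold FinePrm.climC; split_ifs
    · exact hnC
    · exact hnD
  have hKCmax' : (shellD P + nz + 1) * (2 + 1) ≤ KCmax := hKCmax
  have hKC := hKC_of_affine SF haff hU1 P hnF1 hC hU hA hKCmax'
  -- the exit inequalities of the pieces
  have hPex : ∀ (i : Fin 2) (σ₀ : ℤˣ) (c : V), ∀ v ∈ FinePrm.pexF G φ I b Q e f i σ₀ c, v ∈ Rg c ∧
      (pr.sideFormsU_frame φ t I b hc hA0.ne' hnz hD (lo - (j : Site 2)) (hi + (j : Site 2)) i σ₀).lin (φ v) + P.A + pr.climC I b i ≤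
        (pr.sideFormsU_frame φ t I b hc hA0.ne' hnz hD (lo - (j : Site 2)) (hi + (j : Site 2)) i σ₀).lin (φ c) := fun i σ₀ c v hv =>
    ⟨hQRg i σ₀ c hv, pr.hPex_pexF t I b hc hA0.ne' hnz hD hLI _ _ hA0 hn he hf hev hfv Q hnS hexα hexβ hex₁ hex₀ i σ₀ c v hv⟩
  refine kitClause_frame hlipφ hstep hfr hκ hΔ hδ pr t I b hc₀ hc₁ hD hL0 hL1 hc hA0.ne' hb hnz hnC hU3 P hPN hA hd1 hD1 hD2 hDρ hℓ hW hKmax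
    hKCmax hR' hwide hdw hDw hT hT' hr₀ hR hrs hcS Rg hRg hRgcard hcU1 Λc kz hkn hΛ (FinePrm.pexF G φ I b Q e f) hPex kk o Sfin hWD hXD hN hk
    (fun x hx hfar => ?_) (fun x hx hnear => ?_)
  · -- FAR: the inner neighbour lies in the level and outside `B(w₀, R − r₀)`
    refine hfarT _ ?_ hfar
    have h := inNbr_spec (G := G) (φ := ψ) (by rw [hKeq] at hx; exact hx)
    rw [hKeq]
    exact (mem_Win G ψ).2 ⟨h.2.1, h.2.2⟩
  · -- NEAR: zone, exit link, route at the kit centre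
    refine Or.inr ⟨hzone _, hexit _ _ _, ?_⟩
    have hx' : x ∈ outerBoundary (winGraph G w₀ R) (Win G ψ w₀ (Finset.Icc (lo - (j : Site 2)) (hi + (j : Site 2))) R) := by
      rw [hKeq] at hx; exact hx
    set c := ctCtr G SF P w₀ R x with hcdef
    have hcI : ψ c ∈ Finset.Icc (lo - ((E : ℕ) : Site 2)) (hi + ((E : ℕ) : Site 2)) :=
      ψ_ctCtr_mem_Icc SF hlip hq hstep hwide (fun i σ₀ z h1 _ => hKC i σ₀ z h1) hE hx
    have hcw : c ∈ graphBall G w₀ (R - r) := by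
      have hd := ctCtr_reach SF hlip hq hstep hwide (fun i σ₀ z h1 _ => hKC i σ₀ z h1) hx'
      have h := BoxProdZ2.mem_graphBall_add G hnear hd
      exact graphBall_mono G _ (by omega) h
    exact hroute c hcI hcw

end Skelφ

end Summit.CriticalPhenomena.PercolationContinuityZ3.Theorems.Transplant

end
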